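import Summits.BirchSwinnertonDyer.BirchSwinnertonDyer.Theorems.ClassRecordThreeRegCertKernelHeight
import Summits.BirchSwinnertonDyer.Rank1Residual.X11b.RegMultCertificateJoin
import Literature.NumberTheory.EllipticCurves.CanonicalPAdicHeightAdmissibilityCriteria
import Literature.NumberTheory.EllipticCurves.Tamagawa
import HarnessLib

/-!
# Route `ClassRecordThree`, crux `SchneiderAtThree` (item 19106): the REG3CERT KERNEL CERTIFICATE CHECKER —
# from one row's integers to `RegMult.CertNonsplit W 3 Q 1` and to the rung
# `GZK → (ClassX11b W 3 → Ram W 3 → ¬ split(3) → ClassClosure.RegulatorNonvanishingAt W 3)`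
# (cell `bsd-stepL`, seat `bsd-stepL-reg3-eng` g3; `--supports stmt-BirchSwinnertonDyer-19106`)

HONEST FRAMING: BSD is not proved by any of this; nothing here closes the crux; Schneider's non-degeneracy conjecture
(barrier `PAdicHeightNondegeneracy`) is asserted NOWHERE; every application is ONE curve. This file turns a row of the
REG3CERT table (kit j249075 / j249895; `run/shared/lean/pub/bsd-stepL/reg3/REG3CERT-TABLE.md`) — so far EVIDENCE, a
`3`-adic ball computed by an engine — into a KERNEL-CHECKABLE certificate: the row's data are the integer model
`⟨a₁,…,a₆⟩`, the certificate point `Q = (a/e², b/e³)` (`e = 3e'`) and six residues `(γ, ζ, ℓ, ω, κ, u)`; the checker's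
hypotheses are integer (in)equalities and divisibilities, each decided per row by `norm_num`/`decide`; its conclusions
are

* `certNonsplit_of_residueCert : RegMult.CertNonsplit W 3 Q 1` — admissibility of `Q` at `3` (non-torsion as
  `Q ∈ E₁(ℚ₃)`, `3` odd; `z(Q)` in the sigma disc; non-singular reduction at EVERY prime by the gcd test
  `gcd(Φ_y·e³, Φ_x·e⁴) ∣ eⁿ`, `hasNonsingularReductionAt_of_gcd`) AND the height inequality
  `heightFourOneCoord W 3 q x y ≠ 0` for every `‖q‖₃ < 1` (`heightFourOneCoord_ne_zero_of_residueCert`, parts 1–2);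
* `rung_of_cert : GZK → (ClassX11b W 3 → Ram W 3 → ¬ split(3) → ClassClosure.RegulatorNonvanishingAt W 3)` for a
  point on the curve all of whose renderings carry the certificate (join `RegMult.regulatorNonvanishingAt_of_cert_of_
  not_split` at GZK rank one — the same one-line join as `RegMult.schneiderAtThree_at_of_certNonsplit`, p419044) and its
  Kolyvagin-road twin `rungTam_of_cert` (item 19154; same join as `RegMult.schneiderTamAtThree_at_of_certNonsplit`,
  p420890).

Scope: rows with `v₃(e(Q)) = 1 = v₃(h(Q))` (314 of the 723 TRUE-OPEN non-split (ram) X11b@3 rows; the other rows need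
the second-order expansion). Theorems only (0 defs, 0 facts). IMPORTS (standing build rule 2026-08-26, seat g5): this
checker — hence every REG3CERT checker and row file above it — imports only ROUTE-FREE modules
(`X11b/RegMultCertificateJoin.lean`, Literature); no `Theses/*.lean` route file lies in its import closure, so route
edits never rebuild the certificate tower (statements unchanged from g3's p432582). References: [SteinWuthrich2013]
§4.2; [MazurSteinTate2006] §1; [SilvermanAEC2009] VII.2.1, VII.3.4; [KolyvaginEulerSystems1990] Thm. A (GZK).
-/

open scoped Classical

open WeierstrassCurve Literature.NumberTheory.EllipticCurves
  Literature.NumberTheory.EllipticCurves.Rank1Residual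
  Literature.NumberTheory.EllipticCurves.SteinWuthrich2013
  Summit.BirchSwinnertonDyer.Rank1Residual
  Summit.BirchSwinnertonDyer.Rank1Residual.X11b

namespace Summit.BirchSwinnertonDyer.Rank1Residual.X11b.RegMult.KernelCert

/-! ### §1 The integer model read in `ℚ₃` -/

section Model

variable (W : WeierstrassCurve ℚ) {a₁ a₂ a₃ a₄ a₆ : ℤ} (hW : W = ⟨a₁, a₂, a₃, a₄, a₆⟩)
include hW

/-- `a₁(W ⊗ ℚ₃) = a₁`. [folklore] -/
theorem baseChange_a₁_eq : (W.baseChange ℚ_[3]).a₁ = a₁ := by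
  subst hW; rw [WeierstrassCurve.baseChange, WeierstrassCurve.map_a₁]; simp

/-- `a₂(W ⊗ ℚ₃) = a₂`. [folklore] -/
theorem baseChange_a₂_eq : (W.baseChange ℚ_[3]).a₂ = a₂ := by
  subst hW; rw [WeierstrassCurve.baseChange, WeierstrassCurve.map_a₂]; simp

/-- `c₄(W ⊗ ℚ₃) = b₂² − 24b₄` as an integer. [folklore] -/
theorem baseChange_c₄_eq {c4 : ℤ} (hc4 : c4 = (a₁ ^ 2 + 4 * a₂) ^ 2 - 24 * (2 * a₄ + a₁ * a₃)) :
    (W.baseChange ℚ_[3]).c₄ = c4 := by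
  subst hW; subst hc4
  rw [WeierstrassCurve.baseChange, WeierstrassCurve.map_c₄]
  simp only [WeierstrassCurve.c₄, WeierstrassCurve.b₂, WeierstrassCurve.b₄, map_sub, map_mul, map_pow, map_add,
    map_ofNat, eq_ratCast, Rat.cast_intCast]
  push_cast; ring

/-- `c₆(W ⊗ ℚ₃) = −b₂³ + 36b₂b₄ − 216b₆` as an integer. [folklore] -/
theorem baseChange_c₆_eq {c6 : ℤ}
    (hc6 : c6 = -(a₁ ^ 2 + 4 * a₂) ^ 3 + 36 * (a₁ ^ 2 + 4 * a₂) * (2 * a₄ + a₁ * a₃) - 216 * (a₃ ^ 2 + 4 * a₆)) :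
    (W.baseChange ℚ_[3]).c₆ = c6 := by
  subst hW; subst hc6
  rw [WeierstrassCurve.baseChange, WeierstrassCurve.map_c₆]
  simp only [WeierstrassCurve.c₆, WeierstrassCurve.b₂, WeierstrassCurve.b₄, WeierstrassCurve.b₆, map_sub, map_mul,
    map_pow, map_add, map_neg, map_ofNat, eq_ratCast, Rat.cast_intCast]
  push_cast; ring

end Model

/-! ### §2 The certificate point `Q = (a/e², b/e³)`: on the curve, non-singular reduction everywhere, in `E₁(ℚ₃)` -/

section Point

variable (W : WeierstrassCurve ℚ) {a₁ a₂ a₃ a₄ a₆ : ℤ} (hW : W = ⟨a₁, a₂, a₃, a₄, a₆⟩)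
  {a b : ℤ} {e : ℕ} (he : e ≠ 0) {x y : ℚ} (hx : x = a / (e : ℚ) ^ 2) (hy : y = b / (e : ℚ) ^ 3)
include hW he hx hy

/-- `Φ_y(Q) = (2b + a₁ae + a₃e³)/e³`. [folklore] -/
theorem polynomialY_eq : W.toAffine.polynomialY.evalEval x y =
    ((2 * b + a₁ * a * e + a₃ * e ^ 3 : ℤ) : ℚ) / (e : ℚ) ^ 3 := by
  subst hW
  have he' : (e : ℚ) ≠ 0 := by exact_mod_cast he
  rw [WeierstrassCurve.Affine.evalEval_polynomialY, hx, hy]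
  push_cast; field_simp

/-- `Φ_x(Q) = (a₁be − (3a² + 2a₂ae² + a₄e⁴))/e⁴`. [folklore] -/
theorem polynomialX_eq : W.toAffine.polynomialX.evalEval x y =
    ((a₁ * b * e - (3 * a ^ 2 + 2 * a₂ * a * e ^ 2 + a₄ * e ^ 4) : ℤ) : ℚ) / (e : ℚ) ^ 4 := by
  subst hW
  have he' : (e : ℚ) ≠ 0 := by exact_mod_cast he
  rw [WeierstrassCurve.Affine.evalEval_polynomialX, hx, hy]
  push_cast; field_simp

omit hW hy in
/-- `ord_ℓ x(Q) < 0` at every prime `ℓ ∣ e` (`x = a/e²`, `gcd(a, e) = 1`). [folklore] -/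
theorem padicValRat_x_neg (hcop : Nat.Coprime a.natAbs e) {ℓ : ℕ} [Fact ℓ.Prime] (hℓe : ℓ ∣ e) :
    padicValRat ℓ x < 0 := by
  have hℓ : ℓ.Prime := Fact.out
  have hℓa : ¬ (ℓ : ℤ) ∣ a := by
    intro h
    have h1 : ℓ ∣ a.natAbs := Int.natCast_dvd.mp h
    have h2 : ℓ ∣ Nat.gcd a.natAbs e := Nat.dvd_gcd h1 hℓe
    rw [hcop] at h2
    exact hℓ.one_lt.ne' (Nat.dvd_one.mp h2)
  have ha0 : (a : ℚ) ≠ 0 := by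
    have : a ≠ 0 := fun h => hℓa (h ▸ dvd_zero _)
    exact_mod_cast this
  have he' : (e : ℚ) ≠ 0 := by exact_mod_cast he
  have hva : padicValRat ℓ (a : ℚ) = 0 := by
    rw [padicValRat.of_int, padicValInt.eq_zero_of_not_dvd hℓa]; simp
  have hve : padicValRat ℓ ((e : ℚ) ^ 2) = 2 * (padicValNat ℓ e : ℤ) := by
    rw [padicValRat.pow, padicValRat.of_nat]; push_cast; ring
  rw [hx, padicValRat.div ha0 (pow_ne_zero 2 he'), hva, hve]
  have h1 : (1 : ℤ) ≤ (padicValNat ℓ e : ℤ) := by exact_mod_cast one_le_padicValNat_of_dvd he hℓe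
  omega

omit hW he hx hy in
/-- The gcd test excludes, at a prime `ℓ ∤ e`, that `ℓ` divides both `A = Φ_y·e³` and `B = Φ_x·e⁴`. [folklore] -/
theorem not_dvd_or_not_dvd_of_gcd {A B : ℤ} {n : ℕ} (hgcd : Int.gcd A B ∣ e ^ n) {ℓ : ℕ} (hℓ : ℓ.Prime)
    (hℓe : ¬ ℓ ∣ e) : ¬ (ℓ : ℤ) ∣ A ∨ ¬ (ℓ : ℤ) ∣ B := by
  by_cases hA : (ℓ : ℤ) ∣ A
  · by_cases hB : (ℓ : ℤ) ∣ B
    · have h1 : (ℓ : ℤ) ∣ (Int.gcd A B : ℤ) := Int.dvd_coe_gcd hA hB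
      have h2 : ℓ ∣ Int.gcd A B := Int.natCast_dvd_natCast.mp h1
      exact absurd (hℓ.dvd_of_dvd_pow (h2.trans hgcd)) hℓe
    · exact Or.inr hB
  · exact Or.inl hA

/-- **`Q` reduces to a non-singular point modulo EVERY prime** (`HasNonsingularReductionAt`, clause A3 of a
REG3CERT row) from the exact gcd test: with `A = 2b + a₁ae + a₃e³ = Φ_y(Q)·e³`, `B = a₁be − (3a² + 2a₂ae² + a₄e⁴) =
Φ_x(Q)·e⁴` and `gcd(A, B) ∣ eⁿ`, a prime `ℓ ∣ e` has `ord_ℓ x(Q) < 0`, and a prime `ℓ ∤ e` has `Φ_y(Q)` or `Φ_x(Q)` an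
`ℓ`-adic unit. [Silverman AEC VII.2.1] [cite: SilvermanAEC2009, VII.2.1] [cite: MazurSteinTate2006, §1] -/
theorem hasNonsingularReductionAt_of_gcd (hcop : Nat.Coprime a.natAbs e) {n : ℕ}
    (hgcd : Int.gcd (2 * b + a₁ * a * e + a₃ * e ^ 3) (a₁ * b * e - (3 * a ^ 2 + 2 * a₂ * a * e ^ 2 + a₄ * e ^ 4)) ∣
      e ^ n) (ℓ : ℕ) (hℓ : ℓ.Prime) : W.HasNonsingularReductionAt ℓ x y := by
  haveI : Fact ℓ.Prime := ⟨hℓ⟩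
  by_cases hℓe : ℓ ∣ e
  · exact Or.inl (padicValRat_x_neg he hx hcop hℓe)
  · have he' : (e : ℚ) ≠ 0 := by exact_mod_cast he
    have hve : padicValRat ℓ (e : ℚ) = 0 := by
      rw [← padicValRat_of_nat, padicValNat.eq_zero_of_not_dvd hℓe]; rfl
    rcases not_dvd_or_not_dvd_of_gcd hgcd hℓ hℓe with hA | hB
    · -- `Φ_y(Q)` is an `ℓ`-adic unit
      have hA0 : ((2 * b + a₁ * a * e + a₃ * e ^ 3 : ℤ) : ℚ) ≠ 0 := by
        have : (2 * b + a₁ * a * e + a₃ * e ^ 3 : ℤ) ≠ 0 := fun h => hA (h ▸ dvd_zero _)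
        exact_mod_cast this
      refine Or.inr (Or.inr ⟨?_, ?_⟩)
      · rw [polynomialY_eq W hW he hx hy]; exact div_ne_zero hA0 (pow_ne_zero 3 he')
      · rw [polynomialY_eq W hW he hx hy, padicValRat.div hA0 (pow_ne_zero 3 he'), padicValRat.pow _, hve,
          padicValRat.of_int, padicValInt.eq_zero_of_not_dvd hA]
        simp
    · -- `Φ_x(Q)` is an `ℓ`-adic unit
      have hB0 : ((a₁ * b * e - (3 * a ^ 2 + 2 * a₂ * a * e ^ 2 + a₄ * e ^ 4) : ℤ) : ℚ) ≠ 0 := by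
        have : (a₁ * b * e - (3 * a ^ 2 + 2 * a₂ * a * e ^ 2 + a₄ * e ^ 4) : ℤ) ≠ 0 := fun h => hB (h ▸ dvd_zero _)
        exact_mod_cast this
      refine Or.inr (Or.inl ⟨?_, ?_⟩)
      · rw [polynomialX_eq W hW he hx hy]; exact div_ne_zero hB0 (pow_ne_zero 4 he')
      · rw [polynomialX_eq W hW he hx hy, padicValRat.div hB0 (pow_ne_zero 4 he'), padicValRat.pow _, hve,
          padicValRat.of_int, padicValInt.eq_zero_of_not_dvd hB]
        simp

end Point

/-! ### §3 The certificate and the rung from one row's integers -/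

/-- **`RegMult.CertNonsplit W 3 Q 1` from a REG3CERT residue certificate.** For the integer model
`W = ⟨a₁,…,a₆⟩` (globally minimal, elliptic) and a point `Q = (x, y) = (a/e², b/e³)` of `W` with `e = 3e'`, the single
hypothesis `H` is the conjunction of the row's INTEGER facts — `c₄, c₆` in terms of the `aᵢ`, `3 ∤ c₆`, `3 ∤ e'`, `3 ∤ b`,
`gcd(a, e) = 1`, the gcd reduction test `gcd(Φ_y·e³, Φ_x·e⁴) ∣ eⁿ`, and the residues `(γ, ζ, ℓ, ω, κ, u)` with
`9 ∣ c₄ + γc₆`, `3 ∤ γ`, `81 ∣ ae + ζb`, `3⁵ ∣ 6ζ + 3a₁ζ² + 2(a₁²+a₂)ζ³ − 6ℓ`, `9 ∣ ω`, `81 ∣ ℓ² − ωγ`, `9 ∣ κ`,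
`3⁵ ∣ ω² + 12ω − 24κ`, `9u = 2γκ`, `3 ∤ u`, **`9 ∤ e'⁴ − u²`** — decided per row by ONE `norm_num`. Conclusion: `Q = 1 • Q`
is admissible at `3` (tree `isAdmissible_of_one_lt_norm`: AEC VII.3.4 for non-torsion, `hasNonsingularReductionAt_of_gcd`)
and its Stein–Wuthrich §4.2 height is non-zero for every `‖q‖₃ < 1` (`heightFourOneCoord_ne_zero_of_residueCert`).
Per curve; nothing class-wide. [cite: SteinWuthrich2013, §4.2] [cite: MazurSteinTate2006, §1] [cite: SilvermanAEC2009, VII.3.4] -/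
theorem certNonsplit_of_residueCert (W : WeierstrassCurve ℚ) {a₁ a₂ a₃ a₄ a₆ : ℤ} (hW : W = ⟨a₁, a₂, a₃, a₄, a₆⟩)
    [W.IsElliptic] [W.IsGloballyMinimal] {a b c4 c6 γ ζ ℓ ω κ u : ℤ} {e' n : ℕ}
    (H : c4 = (a₁ ^ 2 + 4 * a₂) ^ 2 - 24 * (2 * a₄ + a₁ * a₃) ∧
      c6 = -(a₁ ^ 2 + 4 * a₂) ^ 3 + 36 * (a₁ ^ 2 + 4 * a₂) * (2 * a₄ + a₁ * a₃) - 216 * (a₃ ^ 2 + 4 * a₆) ∧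
      ¬ (3 : ℤ) ∣ c6 ∧ ¬ (3 : ℤ) ∣ e' ∧ ¬ (3 : ℤ) ∣ b ∧ Nat.Coprime a.natAbs (3 * e') ∧
      Int.gcd (2 * b + a₁ * a * (3 * e' : ℕ) + a₃ * (3 * e' : ℕ) ^ 3)
        (a₁ * b * (3 * e' : ℕ) - (3 * a ^ 2 + 2 * a₂ * a * (3 * e' : ℕ) ^ 2 + a₄ * (3 * e' : ℕ) ^ 4)) ∣ (3 * e') ^ n ∧
      (9 : ℤ) ∣ c4 + γ * c6 ∧ ¬ (3 : ℤ) ∣ γ ∧ (81 : ℤ) ∣ a * (3 * e' : ℕ) + ζ * b ∧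
      (243 : ℤ) ∣ 6 * ζ + 3 * a₁ * ζ ^ 2 + 2 * (a₁ ^ 2 + a₂) * ζ ^ 3 - 6 * ℓ ∧
      (9 : ℤ) ∣ ω ∧ (81 : ℤ) ∣ ℓ ^ 2 - ω * γ ∧ (9 : ℤ) ∣ κ ∧ (243 : ℤ) ∣ ω ^ 2 + 12 * ω - 24 * κ ∧
      9 * u = 2 * γ * κ ∧ ¬ (3 : ℤ) ∣ u ∧ ¬ (9 : ℤ) ∣ (e' : ℤ) ^ 4 - u ^ 2)
    {x y : ℚ} (hx : x = a / ((3 * e' : ℕ) : ℚ) ^ 2) (hy : y = b / ((3 * e' : ℕ) : ℚ) ^ 3)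
    (h : W.toAffine.Nonsingular x y) : RegMult.CertNonsplit W 3 (.some x y h) 1 := by
  obtain ⟨hc4, hc6, h3c6, h3e', h3b, hcop, hgcd, hγ, h3γ, hζ, hℓ, hω9, hω, hκ9, hκ, hu, h3u, hcert⟩ := H
  have he'0 : e' ≠ 0 := by rintro rfl; exact h3e' (by simp)
  have he0 : (3 * e' : ℕ) ≠ 0 := by positivity
  have hx1 : 1 < ‖(x : ℚ_[3])‖ := by
    haveI : Fact (Nat.Prime 3) := ⟨Nat.prime_three⟩
    exact (one_lt_norm_ratCast_iff 3 x).mpr (padicValRat_x_neg he0 hx hcop (dvd_mul_right 3 e'))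
  have hadm : W.IsAdmissible 3 (.some x y h) :=
    isAdmissible_of_one_lt_norm (by norm_num) h hx1 (hasNonsingularReductionAt_of_gcd W hW he0 hx hy hcop hgcd)
  refine ⟨by rw [one_smul]; exact hadm, fun q _ hq1 _ => ?_⟩
  rw [one_smul]
  exact heightFourOneCoord_ne_zero_of_residueCert W (baseChange_a₁_eq W hW) (baseChange_a₂_eq W hW)
    (baseChange_c₄_eq W hW hc4) (baseChange_c₆_eq W hW hc6) h3c6 h3e' h3b hcop hx hy hγ h3γ hζ hℓ hω9 hω hκ9 hκ hu
    h3u hcert hq1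

/-- **The rung of crux `SchneiderAtThree` (item 19106) at a certificate's curve, modulo GZK only.** If `(x, y)` lies on
`W` (so it is a non-singular point, `W` being elliptic) and every rendering of that point carries a non-split certificate
`RegMult.CertNonsplit W 3 Q 1`, then from the PUBLISHED fact GZK (`rank_eq_analyticRank_of_analyticRank_le_one`):
`ClassX11b W 3 → Ram W 3 → ¬ split(3) → ClassClosure.RegulatorNonvanishingAt W 3` (join
`RegMult.regulatorNonvanishingAt_of_cert_of_not_split` at Mordell–Weil rank one, `mordellWeilRank_eq_one_of_analyticRank`;
the split clause of the bundled predicate is vacuous at a non-split prime — literally the join of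
`RegMult.schneiderAtThree_at_of_certNonsplit`, p419044, written route-free; the `Ram W 3` binder is not used). ONE
curve; Schneider class-wide asserted nowhere; closes nothing by itself.
[cite: SteinWuthrich2013, §4.2 and Conj. 4.1] [cite: KolyvaginEulerSystems1990, Thm. A] -/
theorem rung_of_cert (hGZK : rank_eq_analyticRank_of_analyticRank_le_one) (W : WeierstrassCurve ℚ) [W.IsElliptic]
    [W.IsGloballyMinimal] {x y : ℚ} (hP : W.toAffine.Equation x y)
    (hc : ∀ h : W.toAffine.Nonsingular x y, RegMult.CertNonsplit W 3 (.some x y h) 1) :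
    ClassX11b W 3 → Ram W 3 → ¬ W.HasSplitMultiplicativeReductionAtPrime 3 →
      ClassClosure.RegulatorNonvanishingAt W 3 :=
  fun hX _ hns =>
    RegMult.regulatorNonvanishingAt_of_cert_of_not_split (mordellWeilRank_eq_one_of_analyticRank hGZK hX.1) hns
      (hc ((WeierstrassCurve.Affine.equation_iff_nonsingular (W := W.toAffine)).mp hP))

/-- **The Kolyvagin-road twin** (crux `SchneiderTamAtThree`, item 19154): the same rung with the extra binder
`3 ∣ ∏ c_ℓ`, which is not used (the join of `RegMult.schneiderTamAtThree_at_of_certNonsplit`, p420890, written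
route-free). ONE curve; nothing class-wide. [cite: SteinWuthrich2013, §4.2 and Conj. 4.1]
[cite: KolyvaginEulerSystems1990, Thm. A] -/
theorem rungTam_of_cert (hGZK : rank_eq_analyticRank_of_analyticRank_le_one) (W : WeierstrassCurve ℚ) [W.IsElliptic]
    [W.IsGloballyMinimal] {x y : ℚ} (hP : W.toAffine.Equation x y)
    (hc : ∀ h : W.toAffine.Nonsingular x y, RegMult.CertNonsplit W 3 (.some x y h) 1) :
    ClassX11b W 3 → Ram W 3 → ¬ W.HasSplitMultiplicativeReductionAtPrime 3 → 3 ∣ W.tamagawaProduct →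
      ClassClosure.RegulatorNonvanishingAt W 3 :=
  fun hX hram hns _ => rung_of_cert hGZK W hP hc hX hram hns

end Summit.BirchSwinnertonDyer.Rank1Residual.X11b.RegMult.KernelCert
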